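import Literature.MathematicalPhysics.QuantumLattice.HubbardFermiSeaTangentRowsDiluteFarTPrime
import Literature.MathematicalPhysics.QuantumLattice.HubbardFermiSeaTangentRowsDiluteLa214
import Summits.Ventures.CertifiedManyBodySolver.Certificates.HubbardSquare_U12_n7o8_tpm2o5_lower_row591
import Summits.Ventures.CertifiedManyBodySolver.Certificates.HubbardSquare_U12_n7o8_tpm3o10_lower_row595
import Summits.Ventures.CertifiedManyBodySolver.Certificates.HubbardSquare_U17o2_n7o8_tpm11o20_lower_row616
import Summits.Ventures.CertifiedManyBodySolver.Certificates.HubbardSquare_U17o2_n7o8_tpm3o10_lower_row561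
import Summits.Ventures.CertifiedManyBodySolver.Certificates.HubbardTTPrime_polarizedBandCaps_kernelA
import Summits.Ventures.CertifiedManyBodySolver.Observables.PhaseSeparationExclusionBox
import Summits.Ventures.CertifiedManyBodySolver.Observables.PhaseSeparationExclusionBoxThermalFreeDilute
import Summits.Ventures.CertifiedManyBodySolver.Observables.PhaseSeparationExclusionFarPolThermalAC
import Summits.Ventures.CertifiedManyBodySolver.Observables.PhaseSeparationExclusionFarSevenEighths
import Summits.Ventures.CertifiedManyBodySolver.Observables.PhaseSeparationExclusionSevenEighthsAnchors
import Summits.Ventures.CertifiedManyBodySolver.Observables.PhaseSeparationExclusionSevenEighthsAnchorsThermal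
import HarnessLib
import HarnessLib.Audit

/-!
# Ventures/CertifiedManyBodySolver — Observables/PhaseSeparationExclusionFarPolThermalSEA2C.lean: `(≤ 3/10 | ≥ 7/8)` AT `T > 0` on the near-far segment `t′ ∈ [−7/20, −3/10]` — POLARISED-CAP edition (dense partner down to filling `7/8`)

HONEST FRAMING: first certified bounds; not a superconductivity verdict. CLASS = DERIVED / CONTEXT (competing-order word, CONTROL class: the excluded partner phase has hole
doping `≥ 7/10`, the dense partner any filling `≥ 7/8`). The `T > 0` twins of hubbard-box-p3 g33's «FAR SEVEN-EIGHTHS» `T = 0` words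
(`Observables/PhaseSeparationExclusionFarSevenEighths*`): law `psT_not_thermal_mix_on_cell_of_columns_hotAnchorSS_tcap` / `…above_column…` (this seat g25) with `n₂ = 7/8`;
CAP = kernel FULLY-POLARISED band cap (`Certificates/HubbardTTPrime_polarizedBandCaps_kernel*`, hubbard-box-p3 g33, `U`-independent, no claim node) or the kernel HF /
registry r468 / r450 plane where that gives the lower threshold (named per theorem); `n = 7/8` COLUMNS = hubbard-box-p3's landed laws `fse78_*` / `fse78y_*` / `se78_*` BY NAME —
they rest on the REGISTRY `n = 7/8` corner claim nodes (#551–#556, #590–#595, #613–#616) which enter BY NAME in each signature; DILUTE floors = kernel Fermi-sea tangent rows at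
the segment ends (premise-free); `T > 0` ANCHORS = kernel free gas `β* = 4` at `n₁` (`free4_*`) and the a-priori `2 log 2` at `n₂ = 7/8` (`apriori_hotCap_sevenEighths_on_cell`) — NO thermal claim node.
`β₀ = max(β*, ⌈K/M⌉)` per cell (exact rationals; kernel re-check by `nlinarith`). Cells: `[17 / 2,12]` β ≥ 9 (pol) ∣ `[12,16]` β ≥ 7 (pol).
WHAT THIS IS NOT: a certificate or number of record; CONTROL-class words conditional BY NAME on the registry corner nodes named in each signature; canonical sector-Gibbs torus
limits (existence not claimed); nothing about stripes as states, ferromagnetism, superconductivity or `T_c`.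

Seat hubbard-downfold-unc-2 g30; generator `pub/hubbard-downfold/hubbard-downfold-unc-2/gen-g30/yb/gen30_78.py` (column tables from hubbard-box-p3's `work-g33/far78/emit_far78.py`).
[cite: Israel1979, Thm. I.2.4] [cite: EmeryKivelsonLin1990, pp. 475–476] [cite: PoulinHastings2011, eqs. (3)–(8)] [cite: Griffiths1966, §II] [cite: Ruelle1969, §3.4] [cite: BachLiebSolovej1994, eq. (2c.36)] [cite: LiebLoss1993, §8, Theorem 8.2]
-/

noncomputable section

namespace Summit.Ventures.CertifiedManyBodySolver.Observables

open Summit.Ventures.CertifiedManyBodySolver.Certificates Summit.Ventures.CertifiedManyBodySolver.Downfold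
open Literature.MathematicalPhysics.QuantumLattice Literature.MathematicalPhysics.QuantumLattice.ThermodynamicLimit
open Literature.MathematicalPhysics.QuantumLattice.InfVolFermionState Set Filter

/-! ## `(≤ 3/10 | ≥ 7/8)` at `T > 0`, segment A2: `t′ ∈ [-7 / 20, -3 / 10]` -/

/-- **`(≤ 3/10 | ≥ 7/8)` at `T > 0` — segment A2 `t′ ∈ [-7 / 20, -3 / 10]`, columns `U ∈ [17 / 2, 12]`, EVERY `β ≥ 9`** (`T ≲ 490–774 K` for `t ∈ [0.38, 0.60] eV`).
Witness filling `1 / 2` (weights `a, b = 15 / 23, 8 / 23`); cap = the PROVED kernel FULLY-POLARISED band cap `polHalf_m40m30` (one spin species at density `1 / 2`, `U`-independent; no claim node); `n = 7/8` column laws `fse78_col17o2_m55m30` ∣ `se78_col12_m40m30` (hubbard-box-p3 g30/g33, BY NAME; the registry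
`n = 7/8` corner claim nodes they rest on enter BY NAME in the signature); dilute floor = `t′`-chord of the kernel rows `fermiSeaTangentRow_tPrime_neg_seven_div_twenty_at_three_div_ten` / `fermiSeaTangentRow_tPrime_neg_three_div_ten_at_three_div_ten`;
kernel free-gas dilute anchor `β* = 4` (`free4_3o10_tpm7o20_tpm3o10`), a-priori `n₂ = 7/8` anchor `2 log 2` (`apriori_hotCap_sevenEighths_on_cell`) — NO thermal claim node. Exact column data at `s = -7 / 20 ∣ -3 / 10`
(`T = 0` margin M, anchored ratio K/M; `β₀ = max(β*, ⌈K/M⌉)`): `U = 17 / 2`: M 0.0959∣0.0710, K/M 6.41∣8.33; `U = 12`: M 0.1210∣0.0948, K/M 5.08∣6.23. [cite: Israel1979, Thm. I.2.4] [cite: EmeryKivelsonLin1990, pp. 475–476] [cite: PoulinHastings2011, eqs. (3)–(8)] [cite: Griffiths1966, §II] [cite: Ruelle1969, §3.4] -/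
theorem fpT78_3o10_A2_17o2to12_beta9 (h616 : cert_r616_bs_GU17o2n7o8tpm11o20_w3_b4_R2_ob5p2_kry1_kry2c3rel_hanK7B4D4_KN4_PR20d4_uprime) (h561 : cert_r561_bs_GU17o2n7o8tpm3o10_w3_b4_R2_ob5p2_kry1_kry2c3rel_hanK7B4D4_KN4_PR20d4_hanK8c2s_uprime) (h591 : cert_r591_bs_GU12n7o8tpm2o5_w3_b4_R2_ob5p2_kry1_kry2c3rel_hanK7B4D4_KN4_PR20d4_uprime) (h595 : cert_r595_bs_GU12n7o8tpm3o10_w3_b4_R2_ob5p2_kry1_kry2c3rel_hanK7B4D4_KN4_PR20d4_uprime)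
    {s : ℝ} (hs : s ∈ Icc (-7 / 20 : ℝ) (-3 / 10)) {U : ℝ} (hU : U ∈ Icc (17 / 2 : ℝ) (12))
    {β : ℝ} (hβ : (9 : ℝ) ≤ β)
    {ω₁ ω₂ : InfVolFermionState 2} (h₁ : ω₁.IsTranslationInvariant) (h₂ : ω₂.IsTranslationInvariant)
    (hρ₁ : 0 < ω₁.density) (hρ₁' : ω₁.density ≤ 3 / 10) (hρ₂ : 7 / 8 ≤ ω₂.density) (hρ₂' : ω₂.density < 2)
    {n : ℝ} (hn0 : 0 < n) (hn2 : n < 2) {lam : ℝ} (hl0 : 0 < lam) (hl1 : lam < 1) {Ls : ℕ → ℕ}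
    (hLs : Tendsto Ls atTop atTop) :
    ¬ (mix lam hl0.le hl1.le ω₁ ω₂).IsTorusLimitOfMixture (sectorGibbsCount n) (fun L => sectorGibbsWeightTT' β 1 s U n L)
      (fun L => sectorGibbsVectorTT' 1 s U n L) Ls := by
  refine psT_not_thermal_mix_on_cell_of_columns_hotAnchorSS_tcap 1 (s₁ := -7 / 20) (s₂ := -3 / 10) (U₁ := 17 / 2) (U₂ := 12)
    (n₁ := 3 / 10) (n₂ := 7 / 8) (a := 15 / 23) (b := 8 / 23) (β₀ := 9) (βh₁ := 4) (βh₂ := 0)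
    (c₀ := ((-7920811/10000000 : ℚ) : ℝ)) (cs := ((1270943/10000000 : ℚ) : ℝ)) (c₁ := ((0 : ℚ) : ℝ))
    (by norm_num) (by norm_num) (by norm_num) (by norm_num) (by norm_num) (by norm_num) (by norm_num) (by norm_num)
    (by norm_num) (by norm_num) (by norm_num) (by norm_num) hβ (by norm_num)
    (polHalf_m40m30_tcap_on_cell (by norm_num) (by norm_num) (by norm_num) (by norm_num))
    (fun s hs => fse78_col17o2_m55m30 h616 h561 s ⟨hs.1.trans' (by norm_num), hs.2.trans (by norm_num)⟩)
    (fun s hs => se78_col12_m40m30 h591 h595 s ⟨hs.1.trans' (by norm_num), hs.2.trans (by norm_num)⟩)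
    (fun s hs U hU => floor_on_cell_of_tPrime_end_rows 1 (n := 3 / 10) (by norm_num) (by norm_num) (by norm_num)
      (fun _ hU' => fermiSeaTangentRow_tPrime_neg_seven_div_twenty_at_three_div_ten hU' (by norm_num) (by norm_num)) (fun _ hU' => fermiSeaTangentRow_tPrime_neg_three_div_ten_at_three_div_ten hU' (by norm_num) (by norm_num)) s hs U (by linarith [hU.1]))
    (free4_3o10_tpm7o20_tpm3o10 (by norm_num) (by norm_num) (by norm_num))
    (apriori_hotCap_sevenEighths_on_cell (by norm_num))
    ?_ ?_ ?_ ?_ hs hU h₁ h₂ hρ₁ hρ₁' hρ₂ hρ₂' hn0 hn2 hl0 hl1 hLs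
  · intro s hs; obtain ⟨h1, h2⟩ := hs; push_cast; norm_num; nlinarith [h1, h2]
  · intro s hs; obtain ⟨h1, h2⟩ := hs; push_cast; norm_num; nlinarith [h1, h2]
  · intro s hs; obtain ⟨h1, h2⟩ := hs; push_cast; norm_num; nlinarith [h1, h2]
  · intro s hs; obtain ⟨h1, h2⟩ := hs; push_cast; norm_num; nlinarith [h1, h2]

/-- **`(≤ 3/10 | ≥ 7/8)` at `T > 0` — segment A2 `t′ ∈ [-7 / 20, -3 / 10]`, ABOVE the column `U = 12` up to `U = 16`, EVERY `β ≥ 7`** (`T ≲ 630–995 K`).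
Cap = the PROVED kernel FULLY-POLARISED band cap `polHalf_m40m30` (one spin species at density `1 / 2`, `U`-independent; no claim node) (`U`-independent) against the Griffiths-monotone `n = 7/8` column law `se78_col12_m40m30` at `U = 12` (floors every larger `U`); dilute rows / anchors as in the
column pieces; law `psT_not_thermal_mix_above_column_hotAnchorSS_tcap`. Far-end data: `U ≥ 12` (cap `U`-independent): M 0.1210∣0.0948, K/M 5.08∣6.23. [cite: Israel1979, Thm. I.2.4] [cite: EmeryKivelsonLin1990, pp. 475–476] [cite: PoulinHastings2011, eqs. (3)–(8)] [cite: Griffiths1966, §II] [cite: Ruelle1969, §3.4] -/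
theorem fpT78_3o10_A2_above12_beta7 (h591 : cert_r591_bs_GU12n7o8tpm2o5_w3_b4_R2_ob5p2_kry1_kry2c3rel_hanK7B4D4_KN4_PR20d4_uprime) (h595 : cert_r595_bs_GU12n7o8tpm3o10_w3_b4_R2_ob5p2_kry1_kry2c3rel_hanK7B4D4_KN4_PR20d4_uprime)
    {s : ℝ} (hs : s ∈ Icc (-7 / 20 : ℝ) (-3 / 10)) {U : ℝ} (hU : U ∈ Icc (12 : ℝ) (16))
    {β : ℝ} (hβ : (7 : ℝ) ≤ β)
    {ω₁ ω₂ : InfVolFermionState 2} (h₁ : ω₁.IsTranslationInvariant) (h₂ : ω₂.IsTranslationInvariant)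
    (hρ₁ : 0 < ω₁.density) (hρ₁' : ω₁.density ≤ 3 / 10) (hρ₂ : 7 / 8 ≤ ω₂.density) (hρ₂' : ω₂.density < 2)
    {n : ℝ} (hn0 : 0 < n) (hn2 : n < 2) {lam : ℝ} (hl0 : 0 < lam) (hl1 : lam < 1) {Ls : ℕ → ℕ}
    (hLs : Tendsto Ls atTop atTop) :
    ¬ (mix lam hl0.le hl1.le ω₁ ω₂).IsTorusLimitOfMixture (sectorGibbsCount n) (fun L => sectorGibbsWeightTT' β 1 s U n L)
      (fun L => sectorGibbsVectorTT' 1 s U n L) Ls := by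
  refine psT_not_thermal_mix_above_column_hotAnchorSS_tcap 1 (s₁ := -7 / 20) (s₂ := -3 / 10) (U₂ := 12) (U₃ := 16)
    (n₁ := 3 / 10) (n₂ := 7 / 8) (a := 15 / 23) (b := 8 / 23) (β₀ := 7) (βh₁ := 4) (βh₂ := 0)
    (c₀ := ((-7920811/10000000 : ℚ) : ℝ)) (cs := ((1270943/10000000 : ℚ) : ℝ)) (c₁ := ((0 : ℚ) : ℝ))
    (by norm_num) (by norm_num) (by norm_num) (by norm_num) (by norm_num) (by norm_num) (by norm_num) (by norm_num)
    (by norm_num) (by norm_num) (by norm_num) (by norm_num) hβ (by norm_num)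
    (polHalf_m40m30_tcap_on_cell (by norm_num) (by norm_num) (by norm_num) (by norm_num))
    (fun s hs => se78_col12_m40m30 h591 h595 s ⟨hs.1.trans' (by norm_num), hs.2.trans (by norm_num)⟩)
    (fun s hs U hU => floor_on_cell_of_tPrime_end_rows 1 (n := 3 / 10) (by norm_num) (by norm_num) (by norm_num)
      (fun _ hU' => fermiSeaTangentRow_tPrime_neg_seven_div_twenty_at_three_div_ten hU' (by norm_num) (by norm_num)) (fun _ hU' => fermiSeaTangentRow_tPrime_neg_three_div_ten_at_three_div_ten hU' (by norm_num) (by norm_num)) s hs U (by linarith [hU.1]))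
    (free4_3o10_tpm7o20_tpm3o10 (by norm_num) (by norm_num) (by norm_num))
    (apriori_hotCap_sevenEighths_on_cell (by norm_num))
    ?_ ?_ hs hU h₁ h₂ hρ₁ hρ₁' hρ₂ hρ₂' hn0 hn2 hl0 hl1 hLs
  · intro s hs; obtain ⟨h1, h2⟩ := hs; push_cast; norm_num; nlinarith [h1, h2]
  · intro s hs; obtain ⟨h1, h2⟩ := hs; push_cast; norm_num; nlinarith [h1, h2]

end Summit.Ventures.CertifiedManyBodySolver.Observables

end
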